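import Summits.Ventures.WeilGRH.WeilSelbergWindows
import Summits.RiemannHypothesis.RiemannHypothesis.Theorems.WeilFormatCEntrySesq
import HarnessLib

/-!
# rh-explicit (venture WeilGRH): THE BEURLING–SELBERG WINDOW BOUNDS IN GRAM FORM — on lattice windows every
  entry is one of Yoshida's matrix coefficients `(χ_n, χ_m)`

Cell `rh-explicit`, WEIL TRACK (structure seat weil-3, gen13).  Measure level, RH-free; continuation of
`WeilSelbergWindows.lean`.

On the LATTICE of heights `ω_j = πj/a` (`j ∈ ℤ`) the flat window modulated to height `ω_j` IS Yoshida's basis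
function `χ_{−j}` (`e^{−iω_j x}χ_0 = χ_{−j}`, `modulated_chi_zero_eq_chi`), its window form is the diagonal Gram entry
`gramCoeff a (−j) (−j)` and the cross term of the two endpoints of `[ω_j, ω_{j+N}]` is the off-diagonal entry
`gramCoeff a (−j) (−(j+N))` — Yoshida's (5.15)/(5.16) in closed form (`Literature…YoshidaWindowGram`,
`WeilFormatCEntrySesq.weilWindowSesq_chi`).  Hence, for every positive `μ` representing Weil's form on the tests
of `[-a, a]`, every `j ∈ ℤ`, every `N ∈ ℕ` (`G = gramCoeff a`):

* `two_mul_mul_measureReal_Icc_lattice_le_gram`: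
  `2a·μ[ω_j, ω_{j+N}] ≤ Σ_{m=0}^{N} G(−(j+m), −(j+m)) − (−1)^N N · G(−j, −(j+N))`;
* `gram_le_two_mul_mul_measureReal_Ioo_lattice`:
  `Σ_{m=1}^{N−1} G(−(j+m), −(j+m)) − (−1)^N N · G(−j, −(j+N)) ≤ 2a·μ(ω_j, ω_{j+N})`.

So the Beurling–Selberg bounds of a Weil measure on a lattice window are read off `N + 2` entries of the
format-C Gram matrix, every one of them an explicit finite expression in `a`, the prime powers below `e^{2a}`,
and digamma values at `¼ + iω/2` — no far field, no tail.  Explicit laws: `WeilSelbergWindowLaw.lean`.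

No definitions, no named facts; RH-free.
-/

set_option autoImplicit false

noncomputable section

open Complex Filter Set MeasureTheory
open scoped Real Topology ComplexConjugate

namespace Summit.Ventures.WeilGRH

open Literature.NumberTheory.LFunctions
open Literature.NumberTheory.LFunctions.Yoshida1992 (chi chiCore gramCoeff)
open Summit.RiemannHypothesis.RiemannHypothesis.Theorems.WeilFormatC

variable {a : ℝ}

/-! ## On the lattice the modulated flat windows are Yoshida's basis functions -/

/-- **`e^{iω_n x}χ_0 = χ_n`** (`ω_n = πn/a`): the flat window modulated to a lattice height is a basis function. -/
theorem modulated_chi_zero_eq_chi (a : ℝ) (n : ℤ) :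
    (fun x ↦ cexp (I * ((π * n / a) * x : ℝ)) * chi a 0 x) = chi a n := by
  funext x
  by_cases hx : x ∈ Icc (-a) a
  · rw [chi_apply_of_mem 0 hx, chi_apply_of_mem n hx]
    simp only [Int.cast_zero, mul_zero, zero_mul, zero_div, Complex.exp_zero, mul_one]
    rw [mul_comm]
    congr 1
    congr 1
    push_cast
    ring
  · rw [chi_apply_of_not_mem 0 hx, chi_apply_of_not_mem n hx, mul_zero]

/-- The lattice heights as modulations: `−(ω_j + mπ/a) = π·(−(j+m))/a`. -/
theorem neg_lattice_height (a : ℝ) (j : ℤ) (m : ℕ) :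
    -((π * j / a) + m * π / a) = π * ((-(j + m) : ℤ) : ℝ) / a := by
  push_cast; ring

/-- The window form of a basis function is its diagonal Gram entry: `W_a(χ_n) = gramCoeff a n n`. -/
theorem weilWindowForm_chi_eq_gramCoeff (ha : 0 < a) (n : ℤ) : weilWindowForm a (chi a n) = gramCoeff a n n := by
  have h := weilWindowSesq_chi ha n n
  rw [weilWindowSesq_self] at h
  exact_mod_cast h

/-! ## The Beurling–Selberg window bounds in Gram form -/

/-- **UPPER BEURLING–SELBERG BOUND, GRAM FORM** (RH-free).  For `a > 0`, every positive `μ` representing Weil's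
form on the tests of `[-a, a]`, every `j ∈ ℤ` and `N ∈ ℕ`, with `ω_j = πj/a` and `G = gramCoeff a` (Yoshida's
(5.15)/(5.16)):  `2a·μ[ω_j, ω_{j+N}] ≤ Σ_{m=0}^{N} G(−(j+m), −(j+m)) − (−1)^N N·G(−j, −(j+N))`. -/
theorem two_mul_mul_measureReal_Icc_lattice_le_gram (ha : 0 < a) {μ : Measure ℝ}
    (hμ : ∀ g : ℝ → ℂ, IsWeilTest g → tsupport g ⊆ Icc (-a) a →
      Integrable (fun t : ℝ ↦ ‖weilMellin g (1 / 2 + t * I)‖ ^ 2) μ ∧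
        weilQuadratic g = ((∫ t, ‖weilMellin g (1 / 2 + t * I)‖ ^ 2 ∂μ : ℝ) : ℂ)) (j : ℤ) (N : ℕ) :
    2 * a * μ.real (Icc (π * j / a) (π * j / a + N * π / a)) ≤
      (∑ m ∈ Finset.range (N + 1), gramCoeff a (-(j + m)) (-(j + m))) -
        (-1) ^ N * N * gramCoeff a (-j) (-(j + N)) := by
  have h := two_mul_mul_measureReal_Icc_le_selberg ha hμ (π * j / a) N
  have hdiag : ∀ m : ℕ, weilWindowForm a (fun x ↦ cexp (I * ((-((π * j / a) + m * π / a)) * x : ℝ)) * chi a 0 x) =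
      gramCoeff a (-(j + m)) (-(j + m)) := by
    intro m
    rw [neg_lattice_height, modulated_chi_zero_eq_chi, weilWindowForm_chi_eq_gramCoeff ha]
  have h0 : (fun x ↦ cexp (I * ((-(π * j / a)) * x : ℝ)) * chi a 0 x) = chi a (-j) := by
    have e : -(π * (j : ℝ) / a) = π * ((-j : ℤ) : ℝ) / a := by push_cast; ring
    rw [e]; exact modulated_chi_zero_eq_chi a (-j)
  have hN : (fun x ↦ cexp (I * ((-((π * j / a) + N * π / a)) * x : ℝ)) * chi a 0 x) = chi a (-(j + N)) := by
    have e := neg_lattice_height a j N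
    rw [e]; exact modulated_chi_zero_eq_chi a (-(j + N))
  rw [Finset.sum_congr rfl fun m _ ↦ hdiag m, h0, hN, weilWindowSesq_chi_re ha] at h
  exact h

/-- **LOWER BEURLING–SELBERG BOUND, GRAM FORM** (RH-free).  Same setting:
`Σ_{m=1}^{N−1} G(−(j+m), −(j+m)) − (−1)^N N·G(−j, −(j+N)) ≤ 2a·μ(ω_j, ω_{j+N})`. -/
theorem gram_le_two_mul_mul_measureReal_Ioo_lattice (ha : 0 < a) {μ : Measure ℝ}
    (hμ : ∀ g : ℝ → ℂ, IsWeilTest g → tsupport g ⊆ Icc (-a) a →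
      Integrable (fun t : ℝ ↦ ‖weilMellin g (1 / 2 + t * I)‖ ^ 2) μ ∧
        weilQuadratic g = ((∫ t, ‖weilMellin g (1 / 2 + t * I)‖ ^ 2 ∂μ : ℝ) : ℂ)) (j : ℤ) (N : ℕ) :
    (∑ m ∈ Finset.Ico 1 N, gramCoeff a (-(j + m)) (-(j + m))) -
        (-1) ^ N * N * gramCoeff a (-j) (-(j + N)) ≤
      2 * a * μ.real (Ioo (π * j / a) (π * j / a + N * π / a)) := by
  have h := selberg_le_two_mul_mul_measureReal_Ioo ha hμ (π * j / a) N
  have hdiag : ∀ m : ℕ, weilWindowForm a (fun x ↦ cexp (I * ((-((π * j / a) + m * π / a)) * x : ℝ)) * chi a 0 x) =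
      gramCoeff a (-(j + m)) (-(j + m)) := by
    intro m
    rw [neg_lattice_height, modulated_chi_zero_eq_chi, weilWindowForm_chi_eq_gramCoeff ha]
  have h0 : (fun x ↦ cexp (I * ((-(π * j / a)) * x : ℝ)) * chi a 0 x) = chi a (-j) := by
    have e : -(π * (j : ℝ) / a) = π * ((-j : ℤ) : ℝ) / a := by push_cast; ring
    rw [e]; exact modulated_chi_zero_eq_chi a (-j)
  have hN : (fun x ↦ cexp (I * ((-((π * j / a) + N * π / a)) * x : ℝ)) * chi a 0 x) = chi a (-(j + N)) := by
    have e := neg_lattice_height a j N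
    rw [e]; exact modulated_chi_zero_eq_chi a (-(j + N))
  rw [Finset.sum_congr rfl fun m _ ↦ hdiag m, h0, hN, weilWindowSesq_chi_re ha] at h
  exact h

/-- **THE TWO-SIDED GRAM BRACKET** packaged: for every lattice window both bounds at once. -/
theorem gram_bracket_lattice (ha : 0 < a) {μ : Measure ℝ}
    (hμ : ∀ g : ℝ → ℂ, IsWeilTest g → tsupport g ⊆ Icc (-a) a →
      Integrable (fun t : ℝ ↦ ‖weilMellin g (1 / 2 + t * I)‖ ^ 2) μ ∧
        weilQuadratic g = ((∫ t, ‖weilMellin g (1 / 2 + t * I)‖ ^ 2 ∂μ : ℝ) : ℂ)) (j : ℤ) (N : ℕ) :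
    (∑ m ∈ Finset.Ico 1 N, gramCoeff a (-(j + m)) (-(j + m))) -
          (-1) ^ N * N * gramCoeff a (-j) (-(j + N)) ≤
        2 * a * μ.real (Ioo (π * j / a) (π * j / a + N * π / a)) ∧
      2 * a * μ.real (Ioo (π * j / a) (π * j / a + N * π / a)) ≤
        2 * a * μ.real (Icc (π * j / a) (π * j / a + N * π / a)) ∧
      2 * a * μ.real (Icc (π * j / a) (π * j / a + N * π / a)) ≤
        (∑ m ∈ Finset.range (N + 1), gramCoeff a (-(j + m)) (-(j + m))) -
          (-1) ^ N * N * gramCoeff a (-j) (-(j + N)) := by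
  refine ⟨gram_le_two_mul_mul_measureReal_Ioo_lattice ha hμ j N, ?_,
    two_mul_mul_measureReal_Icc_lattice_le_gram ha hμ j N⟩
  have hfin := Summit.RiemannHypothesis.RiemannHypothesis.Theorems.WeilBochnerMeasure.measure_Icc_lt_top ha hμ
    (π * j / a) (π * j / a + N * π / a)
  exact mul_le_mul_of_nonneg_left (measureReal_mono Ioo_subset_Icc_self hfin.ne) (by linarith)

end Summit.Ventures.WeilGRH

end
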